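import Summits.QuantumAdvantage.QuantumAdvantage.Theorems.InnerDegreeLawsJ
set_option linter.dupNamespace false

/-!
# LabelSurjectiveLaw (lens 4, g29; kernel step K2 of the (c0) road) — COLUMN SATURATION BY A LABELLED QUADRATIC SUBSET-SUM MAP FORCES A LOSS

Blocker `X = AbsorptionDial.NoPerfectPolyOdd` (item 28487); decomp-qadv lens 4 (minimal-counterexample / extremal reduction), g29.
This file is the bookkeeping step (P3) of the face (c0) = `OneQuadNoPerfectOdd` (REFEREE-66v65 kernel road, K2) on top of the tree's
one-sided saturation kill `InnerDegreeDial.loss_of_columnSaturatedRectangle` (part J): it turns the (c0) DATA — every register but `g₀` a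
table of `k` linear forms mod `p`, the register `g₀` a table `H` of `k'` linear forms `Λ` (its labels) and ONE quadratic polynomial
`quadVal M b` — plus a CUT (free coordinates `e : Fin r ↪ Fin n` against a disjoint column pool `B`) into the abstract rectangle of part J.

* inputs indexed by finite sets (`ind A = 1_A`): the forms, the quadratic value (`qSet`), the weight and the prefix weights of `1_A`, and
  their behaviour under a disjoint union (`qSet_union`: the cross term `Σ_{i ∈ A} Σ_{l ∈ A'} (M i l + M l i)` appears);
* ★ `loss_of_labelSurjective`: fix a ROW CLASS of subsets `S'` of the free coordinates — same row label `l₀ = Λ 1_{e(S')}`, same walk datum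
  `ω₀ = (|S'| + |S' ∩ [0,g₀)|) mod 3` — of size `> (n+1)·2p^k + 1`, a column label `m₀` with `H (l₀ + m₀, ·)` NON-CONSTANT (the class is
  «activating») and a column walk datum `β₀` making `g₀` live (`c + g₀ + ω₀ + β₀ ≢ 0 mod 3`).  If the labelled quadratic subset-sum map of
  the column pool `T ↦ (cross_e(T), q_B(T), Λ 1_T, walk(T))` hits EVERY target `(x, t, m₀, β₀)`, `x ∈ 𝔽_p^r`, `t ∈ 𝔽_p` (COLUMN
  SATURATION on the fibre `(m₀, β₀)`), then the strategy has a losing input.  Proof: rows `X_{S'} = 1_{e(S')}`, columns `Y_w = 1_{T(w)}`,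
  `w = (t, x) ∈ 𝔽_p^{r+1}`; on the rectangle `g₀` fires as `G_{S'}(⟨(1, 1_{S'}), w⟩)` with `G_{S'}(z) = H(l₀ + m₀, q(1_{e(S')}) + z)`
  non-constant, the cube rows `(1, 1_{S'})` are injective, and part J's `loss_of_columnSaturatedRectangle` (with `N = 1`, `w₀ = 0`) ends it.

* `loss_of_inertLabels` (Case A of (P3)): if on a subcube the table `H` ignores the quadratic value at every label vector the subcube
  produces, `g₀` is a `k`-form register there and LAW C `loss_on_kForm_subcube` gives a loss on the subcube;
* ★ `loss_of_columnSaturation` ((P3) ASSEMBLED): with an unbalanced cut (`r` free row coordinates, `m` column coordinates, the rest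
  frozen to `0`) and `V'` containing every column label: COLUMN SATURATION of `A ↦ (cross(A), q(1_A), Λ 1_A, walk(A))` onto
  `𝔽_p^r × 𝔽_p × V' × ℤ/3`, the LAW C count `(n+1)·2p^k·(2p−1)^m < (2p)^m` and the class count `3·p^k·|V'|·((n+1)·2p^k + 1) < 2^r` force a
  losing input (Case A by `loss_of_inertLabels`; Case B by pigeonholing the `2^r` row patterns on (row label, walk datum mod 3,
  activating label) and `loss_of_labelSurjective`).

What stays outside the kernel after this file is the SATURATION itself ((P4)–(P7) of the road: the Fourier bias of quadratic-phase subset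
sums on a free set — the analytic heart of (c0)) and the dead classes where it fails (low rank / forms + sparse, killed by LAW C / LAW S′).
-/

open Finset
open Summit.QuantumAdvantage.AdviceFreeQNC0
open Summit.QuantumAdvantage.QuantumAdvantage.Theorems.InnerDegreeDial

namespace Summit.QuantumAdvantage.QuantumAdvantage.Theorems.LabelSurjective
variable {p : ℕ} [Fact p.Prime]
variable {n : ℕ}

/-! ### Inputs indexed by finite sets -/
/-- the indicator input `1_A` of a set of coordinates -/
def ind (A : Finset (Fin n)) : Fin n → Bool := fun i => decide (i ∈ A)

/-- `1_A i = true ↔ i ∈ A` -/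
theorem ind_apply (A : Finset (Fin n)) (i : Fin n) : (ind A i = true) ↔ i ∈ A := by
  simp [ind]

/-- `1_A ∨ 1_{A'} = 1_{A ∪ A'}` -/
theorem bor_ind (A A' : Finset (Fin n)) : bor (ind A) (ind A') = ind (A ∪ A') := by
  funext i
  simp [bor, ind, mem_union]

/-- the linear forms of an indicator input are set sums -/
theorem forms_ind {k : ℕ} (Λ : Fin k → Fin n → ZMod p) (A : Finset (Fin n)) :
    (fun j => ∑ i, if ind A i = true then Λ j i else 0) = fun j => ∑ i ∈ A, Λ j i := by
  funext j
  simp only [ind, decide_eq_true_eq]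
  rw [Finset.sum_ite_mem, univ_inter]

/-- the quadratic polynomial `Σ M i i' u_i u_i' + Σ b i u_i` evaluated at `1_A`, written as a set sum -/
def qSet (M : Fin n → Fin n → ZMod p) (b : Fin n → ZMod p) (A : Finset (Fin n)) : ZMod p :=
  (∑ i ∈ A, ∑ i' ∈ A, M i i') + ∑ i ∈ A, b i

/-- the quadratic polynomial at an indicator input is the set sum `qSet` -/
theorem quadVal_ind (M : Fin n → Fin n → ZMod p) (b : Fin n → ZMod p) (A : Finset (Fin n)) :
    quadVal M b (ind A) = qSet M b A := by
  unfold quadVal qSet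
  simp only [ind, decide_eq_true_eq]
  have key : ∀ f : Fin n → ZMod p, (∑ i, if i ∈ A then f i else 0) = ∑ i ∈ A, f i := fun f => by
    rw [Finset.sum_ite_mem, univ_inter]
  congr 1
  · calc (∑ x, ∑ x', if x ∈ A then (if x' ∈ A then M x x' else 0) else 0)
          = ∑ x, if x ∈ A then (∑ x' ∈ A, M x x') else 0 := by
            refine sum_congr rfl fun x _ => ?_
            split_ifs with hx
            · exact key _
            · simp
      _ = ∑ i ∈ A, ∑ i' ∈ A, M i i' := key _
  · exact key _

/-- the quadratic value of a disjoint union: the two internal values plus the CROSS TERM -/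
theorem qSet_union (M : Fin n → Fin n → ZMod p) (b : Fin n → ZMod p) {A A' : Finset (Fin n)} (h : Disjoint A A') :
    qSet M b (A ∪ A') = qSet M b A + qSet M b A' + ∑ i ∈ A, ∑ l ∈ A', (M i l + M l i) := by
  unfold qSet
  rw [sum_union h, sum_union h]
  simp only [sum_union h, sum_add_distrib]
  have hcomm : (∑ x ∈ A', ∑ x_1 ∈ A, M x x_1) = ∑ i ∈ A, ∑ l ∈ A', M l i := Finset.sum_comm
  rw [hcomm]
  ring

/-- the Hamming weight of `1_A` is `|A|` -/
theorem wt_ind (A : Finset (Fin n)) : wt (ind A) = A.card := by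
  unfold wt
  congr 1
  ext i
  simp [ind]

/-- the prefix weight of `1_A` below `g` is `|A ∩ [0,g)|` -/
theorem wtPrefix_ind (A : Finset (Fin n)) (g : ℕ) : wtPrefix (ind A) g = (A.filter fun i => i.val < g).card := by
  unfold wtPrefix
  congr 1
  ext i
  simp [ind, and_comm]

/-- the walk exponent of `1_A` at cut `g` is `|A| + |A ∩ [0,g)|` -/
theorem walkExp_ind (A : Finset (Fin n)) (g : ℕ) : walkExp (ind A) g = A.card + (A.filter fun i => i.val < g).card := by
  rw [walkExp, wt_ind, wtPrefix_ind]

/-- the walk datum `|A| + |A ∩ [0,g)|` of a set of coordinates -/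
def walkDatum (A : Finset (Fin n)) (g : ℕ) : ℕ := A.card + (A.filter fun i => i.val < g).card

/-- the walk datum is additive over disjoint unions -/
theorem walkDatum_union {A A' : Finset (Fin n)} (h : Disjoint A A') (g : ℕ) :
    walkDatum (A ∪ A') g = walkDatum A g + walkDatum A' g := by
  unfold walkDatum
  rw [card_union_of_disjoint h, filter_union, card_union_of_disjoint (disjoint_filter_filter h)]
  ring

/-- liveness of a cut at an indicator input in terms of the walk datum -/
theorem liveCut_ind (c : ℕ) (A : Finset (Fin n)) (g₀ : Fin (n + 1)) :
    liveCut c (ind A) g₀ = decide ((c + g₀.val + walkDatum A g₀.val) % 3 ≠ 0) := by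
  rw [liveCut, walkExp_ind]
  rfl
/-! ### Cube rows -/

/-- the cube point `1_{S'} ∈ 𝔽_p^r` of a set of free-coordinate indices -/
def cubePt (r : ℕ) (S' : Finset (Fin r)) : Fin r → ZMod p := fun j => if j ∈ S' then 1 else 0

/-- cube points are injective in the index set (`1 ≠ 0` in `𝔽_p`) -/
theorem cubePt_injective (r : ℕ) : Function.Injective (cubePt (p := p) r) := by
  intro S S' h
  ext j
  have hj := congrFun h j
  have hp1 : (1 : ZMod p) ≠ 0 := one_ne_zero
  by_cases h1 : j ∈ S <;> by_cases h2 : j ∈ S' <;> simp_all [cubePt]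

/-- the affine pairing of a cube row with a column target `w = (t, x)`: `⟨(1, 1_{S'}), w⟩ = t + Σ_{j ∈ S'} x_j` -/
theorem lineRep_cubePt_dotProduct (r : ℕ) (S' : Finset (Fin r)) (w : Fin (r + 1) → ZMod p) :
    lineRep p r (cubePt r S') ⬝ᵥ w = w 0 + ∑ j ∈ S', w j.succ := by
  rw [dotProduct, Fin.sum_univ_succ]
  simp only [lineRep, Fin.cons_zero, Fin.cons_succ, one_mul, cubePt]
  congr 1
  simp only [ite_mul, one_mul, zero_mul]
  rw [Finset.sum_ite_mem, univ_inter]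

/-- the cross term against the image of the free coordinates, read through the index set -/
theorem cross_sum_map {r : ℕ} (e : Fin r ↪ Fin n) (M : Fin n → Fin n → ZMod p) (S' : Finset (Fin r)) (T : Finset (Fin n)) :
    (∑ i ∈ S'.map e, ∑ l ∈ T, (M i l + M l i)) = ∑ j ∈ S', ∑ l ∈ T, (M (e j) l + M l (e j)) := by
  rw [sum_map]
/-! ### K2: column saturation on a labelled fibre forces a loss -/

/-- **COLUMN SATURATION BY THE LABELLED QUADRATIC SUBSET-SUM MAP FORCES A LOSS (K2 of the (c0) road; (P3) of REFEREE-66v65).**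
Registers `g ≠ g₀` are tables of `k` linear forms mod `p`; `g₀ = H(Λu, q(u))` reads `k'` linear forms (its labels) and ONE quadratic
polynomial `q = quadVal M b`.  Cut: free coordinates `e : Fin r ↪ Fin n`, a column pool `B` avoiding them.  Row class: the subsets `S'`
of `Fin r` with row label `Σ_{i ∈ e(S')} Λ · i = l₀` and walk datum `≡ ω₀ (mod 3)`, of size `> (n+1)·2p^k + 1`; an ACTIVATING column
label `m₀` (`H(l₀ + m₀, ·)` non-constant) and a column walk datum `β₀` with `c + g₀ + ω₀ + β₀ ≢ 0 (mod 3)`.  COLUMN SATURATION on the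
fibre `(m₀, β₀)`: every target `(x, t) ∈ 𝔽_p^r × 𝔽_p` is hit by some `T ⊆ B` — cross term `Σ_{l ∈ T} (M (e j) l + M l (e j)) = x j` for
all `j`, internal value `q(1_T) = t`, label `Λ 1_T = m₀`, walk datum `≡ β₀`.  Then the strategy loses on some input. -/
theorem loss_of_labelSurjective (hp5 : 5 ≤ p) {k k' r : ℕ} (c : ℕ)
    (y : Fin (n + 1) → (Fin n → Bool) → Bool) (g₀ : Fin (n + 1))
    (lam : Fin (n + 1) → Fin k → Fin n → ZMod p) (F : Fin (n + 1) → (Fin k → ZMod p) → Bool)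
    (hF : ∀ g, g ≠ g₀ → ∀ u, y g u = F g (fun j => ∑ i, if u i = true then lam g j i else 0))
    (Λ : Fin k' → Fin n → ZMod p) (M : Fin n → Fin n → ZMod p) (b : Fin n → ZMod p)
    (H : (Fin k' → ZMod p) → ZMod p → Bool)
    (hy₀ : ∀ u, y g₀ u = H (fun j => ∑ i, if u i = true then Λ j i else 0) (quadVal M b u))
    (e : Fin r ↪ Fin n) (B : Finset (Fin n)) (heB : ∀ j, e j ∉ B)
    (l₀ m₀ : Fin k' → ZMod p) (ω₀ β₀ : ℕ)
    (hH : ∃ z z', H (l₀ + m₀) z ≠ H (l₀ + m₀) z')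
    (hlive : (c + g₀.val + ω₀ + β₀) % 3 ≠ 0)
    (hclass : (n + 1) * (p ^ k * 2) + 1 <
      (univ.filter fun S' : Finset (Fin r) =>
        (fun j => ∑ i ∈ S'.map e, Λ j i) = l₀ ∧ walkDatum (S'.map e) g₀.val % 3 = ω₀ % 3).card)
    (hsurj : ∀ (x : Fin r → ZMod p) (t : ZMod p), ∃ T : Finset (Fin n), T ⊆ B ∧
      (∀ j, (∑ l ∈ T, (M (e j) l + M l (e j))) = x j) ∧ qSet M b T = t ∧
      (fun j => ∑ l ∈ T, Λ j l) = m₀ ∧ walkDatum T g₀.val % 3 = β₀ % 3) :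
    ∃ u, ringWinU c y u = false := by
  classical
  -- the row class and the column choice
  set cls : Finset (Finset (Fin r)) := univ.filter fun S' : Finset (Fin r) =>
      (fun j => ∑ i ∈ S'.map e, Λ j i) = l₀ ∧ walkDatum (S'.map e) g₀.val % 3 = ω₀ % 3 with hcls
  choose T hTB hTx hTq hTμ hTβ using hsurj
  -- columns are indexed by `w = (t, x) ∈ 𝔽_p^{r+1}`
  let col : (Fin (r + 1) → ZMod p) → Finset (Fin n) := fun w => T (fun j => w j.succ) (w 0)
  have hdisj : ∀ (S' : Finset (Fin r)) (w : Fin (r + 1) → ZMod p), Disjoint (S'.map e) (col w) := by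
    intro S' w
    rw [Finset.disjoint_left]
    intro l hl hl'
    rw [mem_map] at hl
    obtain ⟨j, -, rfl⟩ := hl
    exact heB j (hTB _ _ hl')
  obtain ⟨z₁, z₂, hz⟩ := hH
  refine loss_of_columnSaturatedRectangle hp5 (ι := ↥cls) c y g₀ lam F hF
    (fun S' => ind (S'.1.map e)) (fun w => ind (col w)) ?_
    (fun S' z => H (l₀ + m₀) (qSet M b (S'.1.map e) + z)) ?_
    (fun S' => cubePt r S'.1) ?_ 0 1 1 (Matrix.mul_one 1) ?_ ?_ ?_
  · -- disjoint supports
    intro S' w l h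
    rw [ind_apply, ind_apply] at h
    exact Finset.disjoint_left.mp (hdisj S'.1 w) h.1 h.2
  · -- the row tables are non-constant (activating class)
    intro S'
    refine ⟨z₁ - qSet M b (S'.1.map e), z₂ - qSet M b (S'.1.map e), ?_⟩
    simpa only [add_sub_cancel] using hz
  · -- cube rows are injective
    intro S₁ S₂ h
    exact Subtype.ext (cubePt_injective r h)
  · -- the firing pattern of `g₀` on the rectangle
    intro S' w
    have hS' := (mem_filter.mp S'.2).2
    rw [bor_ind, hy₀, forms_ind, quadVal_ind, Matrix.one_mulVec, add_zero, lineRep_cubePt_dotProduct,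
      qSet_union M b (hdisj S'.1 w)]
    have hforms : (fun j => ∑ i ∈ S'.1.map e ∪ col w, Λ j i) = l₀ + m₀ := by
      funext j
      rw [sum_union (hdisj S'.1 w), Pi.add_apply, ← hS'.1, ← hTμ (fun j => w j.succ) (w 0)]
    rw [hforms, hTq, cross_sum_map]
    have hx : (∑ j ∈ S'.1, ∑ l ∈ col w, (M (e j) l + M l (e j))) = ∑ j ∈ S'.1, w j.succ :=
      sum_congr rfl fun j _ => hTx (fun j => w j.succ) (w 0) j
    rw [hx, add_assoc]
  · -- `g₀` is live on the rectangle
    intro S' w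
    have hS' := (mem_filter.mp S'.2).2
    rw [bor_ind, liveCut_ind, walkDatum_union (hdisj S'.1 w), decide_eq_true_eq]
    have h1 := hS'.2
    have h2 : walkDatum (col w) g₀.val % 3 = β₀ % 3 := hTβ (fun j => w j.succ) (w 0)
    intro h0
    apply hlive
    omega
  · -- the class is large
    rw [Fintype.card_coe]
    exact hclass

/-! ### Case A of (P3): inert labels on a subcube put `g₀` among the `k`-form registers (LAW C) -/

/-- **INERT LABELS (Case A of (P3)).**  If on the subcube `fill ρ T ·` the table `H` of `g₀` does not depend on the quadratic value at
ANY label vector the subcube produces, then `g₀` is a `k`-form register there like the others, and LAW C `loss_on_kForm_subcube`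
gives a losing input on the subcube once `(n+1)·2p^k·(2p−1)^m < (2p)^m`.  (Registers `g ≠ g₀` and `g₀` use the same number `k` of
forms; pad with zero forms.) -/
theorem loss_of_inertLabels (hp5 : 5 ≤ p) {m k : ℕ}
    (hcount : (n + 1) * (p ^ k * 2) * (2 * p - 1) ^ m < (2 * p) ^ m) (c : ℕ)
    (y : Fin (n + 1) → (Fin n → Bool) → Bool) (g₀ : Fin (n + 1))
    (lam : Fin (n + 1) → Fin k → Fin n → ZMod p) (F : Fin (n + 1) → (Fin k → ZMod p) → Bool)
    (hF : ∀ g, g ≠ g₀ → ∀ u, y g u = F g (fun j => ∑ i, if u i = true then lam g j i else 0))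
    (Λ : Fin k → Fin n → ZMod p) (M : Fin n → Fin n → ZMod p) (b : Fin n → ZMod p)
    (H : (Fin k → ZMod p) → ZMod p → Bool)
    (hy₀ : ∀ u, y g₀ u = H (fun j => ∑ i, if u i = true then Λ j i else 0) (quadVal M b u))
    (ρ : Fin n → Bool) (T : Fin m ↪ Fin n)
    (hinert : ∀ (v : Fin m → Bool) (z z' : ZMod p),
      H (fun j => ∑ i, if fill ρ T v i = true then Λ j i else 0) z
        = H (fun j => ∑ i, if fill ρ T v i = true then Λ j i else 0) z') :
    ∃ v, ringWinU c y (fill ρ T v) = false := by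
  classical
  refine loss_on_kForm_subcube hp5 hcount c y ρ T
    (fun g j i => if g = g₀ then Λ j (T i) else lam g j (T i))
    (fun g x => if g = g₀ then
        H ((fun j => ∑ i ∈ (univ.map T)ᶜ, if ρ i = true then Λ j i else 0) + x) 0
      else F g ((fun j => ∑ i ∈ (univ.map T)ᶜ, if ρ i = true then lam g j i else 0) + x)) ?_
  intro g v
  by_cases hg : g = g₀
  · subst hg
    simp only [if_true]
    rw [hy₀, hinert v _ 0]
    congr 1
    funext j
    rw [Pi.add_apply, linForm_fill]
  · simp only [if_neg hg]
    rw [hF g hg]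
    congr 1
    funext j
    rw [Pi.add_apply, linForm_fill]

/-! ### (P3) assembled: saturation of the labelled quadratic subset-sum map of the column half decides the instance -/

/-- **(P3) OF THE (c0) ROAD, ASSEMBLED.**  Registers `g ≠ g₀` `k`-form; `g₀ = H(Λu, q(u))` with `k` labels and one quadratic polynomial;
an unbalanced cut: `r` free ROW coordinates `e`, `m` COLUMN coordinates `T` (disjoint; everything else frozen to `0`).  Let `V'` contain
every column label `Λ 1_A`, `A ⊆ T`.  HYPOTHESES: (i) COLUMN SATURATION — for every label `μ ∈ V'`, every walk datum `β` and every target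
`(x, t) ∈ 𝔽_p^r × 𝔽_p` some column set `A ⊆ T` has cross term `x`, internal value `t`, label `μ` and walk datum `≡ β (mod 3)`;
(ii) the LAW C count on the column subcube `(n+1)·2p^k·(2p−1)^m < (2p)^m`; (iii) the class count
`3·p^k·|V'|·((n+1)·2p^k + 1) < 2^r`.  CONCLUSION: a losing input.  PROOF: either some row pattern `S'` makes every label of `V'` inert
(Case A: `loss_of_inertLabels` on the column subcube over `1_{e(S')}`), or every row pattern has an activating label in `V'`; pigeonhole
the `2^r` row patterns by (row label, walk datum mod 3, activating label) and feed the large class to `loss_of_labelSurjective`. -/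
theorem loss_of_columnSaturation (hp5 : 5 ≤ p) {k r m : ℕ} (c : ℕ)
    (y : Fin (n + 1) → (Fin n → Bool) → Bool) (g₀ : Fin (n + 1))
    (lam : Fin (n + 1) → Fin k → Fin n → ZMod p) (F : Fin (n + 1) → (Fin k → ZMod p) → Bool)
    (hF : ∀ g, g ≠ g₀ → ∀ u, y g u = F g (fun j => ∑ i, if u i = true then lam g j i else 0))
    (Λ : Fin k → Fin n → ZMod p) (M : Fin n → Fin n → ZMod p) (b : Fin n → ZMod p)
    (H : (Fin k → ZMod p) → ZMod p → Bool)
    (hy₀ : ∀ u, y g₀ u = H (fun j => ∑ i, if u i = true then Λ j i else 0) (quadVal M b u))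
    (e : Fin r ↪ Fin n) (T : Fin m ↪ Fin n) (heT : ∀ j i, e j ≠ T i)
    (V' : Finset (Fin k → ZMod p))
    (hV' : ∀ A : Finset (Fin n), A ⊆ univ.map T → (fun j => ∑ l ∈ A, Λ j l) ∈ V')
    (hsat : ∀ μ ∈ V', ∀ (β : ℕ) (x : Fin r → ZMod p) (t : ZMod p), ∃ A : Finset (Fin n), A ⊆ univ.map T ∧
      (∀ j, (∑ l ∈ A, (M (e j) l + M l (e j))) = x j) ∧ qSet M b A = t ∧
      (fun j => ∑ l ∈ A, Λ j l) = μ ∧ walkDatum A g₀.val % 3 = β % 3)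
    (hcountA : (n + 1) * (p ^ k * 2) * (2 * p - 1) ^ m < (2 * p) ^ m)
    (hcountB : 3 * p ^ k * V'.card * ((n + 1) * (p ^ k * 2) + 1) < 2 ^ r) :
    ∃ u, ringWinU c y u = false := by
  classical
  -- row label of a row pattern
  let rowLab : Finset (Fin r) → (Fin k → ZMod p) := fun S' j => ∑ i ∈ S'.map e, Λ j i
  have hdisj : ∀ S' : Finset (Fin r), Disjoint (S'.map e) (univ.map T) := by
    intro S'
    rw [Finset.disjoint_left]
    intro l hl hl'
    rw [mem_map] at hl hl'
    obtain ⟨j, -, rfl⟩ := hl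
    obtain ⟨i, -, hi⟩ := hl'
    exact heT j i hi.symm
  by_cases hA : ∃ S' : Finset (Fin r), ∀ μ ∈ V', ∀ z z', H (rowLab S' + μ) z = H (rowLab S' + μ) z'
  · -- Case A: inert labels on the column subcube over the row pattern `S'`
    obtain ⟨S', hS'⟩ := hA
    have hinert : ∀ (v : Fin m → Bool) (z z' : ZMod p),
        H (fun j => ∑ i, if fill (ind (S'.map e)) T v i = true then Λ j i else 0) z
          = H (fun j => ∑ i, if fill (ind (S'.map e)) T v i = true then Λ j i else 0) z' := by
      intro v z z'
      -- the label vector of a point of the subcube = row label + a column label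
      have hlab : (fun j => ∑ i, if fill (ind (S'.map e)) T v i = true then Λ j i else 0)
          = rowLab S' + fun j => ∑ l ∈ (univ.map T).filter (fun l => fill (ind (S'.map e)) T v l = true), Λ j l := by
        funext j
        rw [Pi.add_apply, linForm_fill]
        congr 1
        · -- frozen part: `ρ = 1_{e(S')}` off the column coordinates
          simp only [ind, decide_eq_true_eq]
          rw [Finset.sum_ite_mem]
          refine sum_congr ?_ fun _ _ => rfl
          ext l
          simp only [mem_inter, mem_compl, mem_map, mem_univ, true_and]
          constructor
          · rintro ⟨-, h⟩; exact h
          · intro h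
            refine ⟨?_, h⟩
            rintro ⟨i, hi⟩
            obtain ⟨j, -, hj⟩ := h
            exact heT j i (hj.trans hi.symm)
        · -- free part, as a set sum over the column coordinates switched on
          rw [sum_filter, sum_map]
          refine sum_congr rfl fun i _ => ?_
          simp only [fill_app]
      rw [hlab]
      exact hS' _ (hV' _ (filter_subset _ _)) z z'
    obtain ⟨v, hv⟩ := loss_of_inertLabels hp5 hcountA c y g₀ lam F hF Λ M b H hy₀ (ind (S'.map e)) T hinert
    exact ⟨_, hv⟩
  · -- Case B: every row pattern has an activating label in `V'`
    push Not at hA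
    choose μf hμV hμact using hA
    -- pigeonhole the row patterns by (row label, walk datum mod 3, activating label)
    let cls : Finset (Fin r) → (Fin k → ZMod p) × ℕ × (Fin k → ZMod p) :=
      fun S' => (rowLab S', walkDatum (S'.map e) g₀.val % 3, μf S')
    let tgt : Finset ((Fin k → ZMod p) × ℕ × (Fin k → ZMod p)) := univ ×ˢ (range 3 ×ˢ V')
    have hmaps : ∀ S' ∈ (univ : Finset (Finset (Fin r))), cls S' ∈ tgt := by
      intro S' _
      simp only [tgt, cls, mem_product, mem_univ, true_and, mem_range]
      exact ⟨Nat.mod_lt _ (by norm_num), hμV S'⟩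
    have htgt : tgt.card * ((n + 1) * (p ^ k * 2) + 1) < (univ : Finset (Finset (Fin r))).card := by
      have hc : tgt.card = p ^ k * (3 * V'.card) := by
        simp only [tgt, card_product, card_univ, card_range, Fintype.card_fun, ZMod.card, Fintype.card_fin]
      rw [hc, card_univ, Fintype.card_finset, Fintype.card_fin]
      calc p ^ k * (3 * V'.card) * ((n + 1) * (p ^ k * 2) + 1)
          = 3 * p ^ k * V'.card * ((n + 1) * (p ^ k * 2) + 1) := by ring
        _ < 2 ^ r := hcountB
    obtain ⟨⟨l₀, ω₀, m₀⟩, hmem, hbig⟩ := Finset.exists_lt_card_fiber_of_mul_lt_card_of_maps_to hmaps htgt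
    -- a member of the class: its activating label is `m₀`, its row label `l₀`
    have hne : (univ.filter fun S' : Finset (Fin r) => cls S' = (l₀, ω₀, m₀)).Nonempty := by
      rw [← card_pos]; omega
    obtain ⟨S₀, hS₀⟩ := hne
    have hS₀' : cls S₀ = (l₀, ω₀, m₀) := (mem_filter.mp hS₀).2
    simp only [cls, Prod.mk.injEq] at hS₀'
    obtain ⟨hl₀, hω₀, hm₀⟩ := hS₀'
    have hm₀V : m₀ ∈ V' := hm₀ ▸ hμV S₀
    -- a live column walk datum
    let β₀ : ℕ := if (c + g₀.val + ω₀) % 3 = 0 then 1 else 0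
    have hlive : (c + g₀.val + ω₀ + β₀) % 3 ≠ 0 := by
      simp only [β₀]
      split_ifs with h <;> omega
    refine loss_of_labelSurjective hp5 c y g₀ lam F hF Λ M b H hy₀ e (univ.map T) ?_ l₀ m₀ ω₀ β₀ ?_ hlive ?_ ?_
    · intro j hj
      rw [mem_map] at hj
      obtain ⟨i, -, hi⟩ := hj
      exact heT j i hi.symm
    · obtain ⟨z, z', hzz⟩ := hμact S₀
      refine ⟨z, z', ?_⟩
      rw [← hl₀, ← hm₀]
      exact hzz
    · refine lt_of_lt_of_le hbig (card_le_card ?_)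
      intro S' hS'
      have h := (mem_filter.mp hS').2
      simp only [cls, Prod.mk.injEq] at h
      rw [mem_filter]
      refine ⟨mem_univ _, h.1, ?_⟩
      rw [h.2.1, ← hω₀, Nat.mod_mod]
    · intro x t
      exact hsat m₀ hm₀V β₀ x t
end Summit.QuantumAdvantage.QuantumAdvantage.Theorems.LabelSurjective
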